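import Literature.Computability.Cryptography.RegevSamplerArithFP
import Literature.Computability.Cryptography.RegevSamplerFormats
import HarnessLib

/-!
# Regev 2009, Lemma 3.14 in machine form: the three words of the sampler's classical stage

Topic `Computability/Cryptography` (family `pqc`), grouping namespace `Regev2009.SamplerWords`; sequel of
`RegevSamplerArithFP.lean` (the integer list programs `ytilL`, `sNatL`, `recoverL`, their values and
`CodeFP` facts) and `RegevSamplerFormats.lean` (register formats: readers `readN`/`readZ`, tables
`tableL`/`tableZL`, the point register `pointsWord`, round trips). The classical stage of the sampler
(Regev 2009, proof of Lemma 3.14: "compute `x mod P(L*)` in a second register … using the CVP oracle, we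
can recover `x` … this allows us to uncompute the first register") computes three WORDS, each XOR-ed
onto a register:

* `wordY P n ℓ ℓY` — from the point register (`n` blocks of `ℓ` bits, the grid vector `x̃`) the branch
  `ỹ` as an offset-binary table of width `ℓY` (`wordY_points`: `= tableZ ℓY (ytil I x̃)`);
* `wordS P R n ℓ ℓR` — from the point register the residues `s` in the QUERY format `table ℓR`
  (`wordS_points`: `= table ℓR (sNat I R x̃)`);
* `wordX At sg R n ℓ ℓY ℓR bc` — from the branch register, the residue register and the ANSWER register
  (`tableZ bc` of the oracle's coordinates `c`) the recomposition `recover I R ỹ s c` in the point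
  register's own format (`wordX_tables`: `= tableZ ℓ (recover I R y s c)`), whence **`wordX_points`**: on
  an answer with `s − R·c = ⌊a⌋` the word IS the point register's content `pointsWord Y`, so XOR-ing it
  erases the register exactly (`RegevSamplerArith.recover_eq_of`, `RegevSamplerFormats.tableZL_cellPt`);
* `CodeFP` facts **`codeFP_wordY`**, **`codeFP_wordS`**, **`codeFP_wordX`**.

Everything is proved; definitions have bodies; no named fact is introduced.

## References

* O. Regev, *On lattices, learning with errors, random linear codes, and cryptography*, J. ACM 56
  (2009), art. 34; author's version arXiv:2401.03703: Lemma 3.14 (proof), §2 p. 11 [Regev2009].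
* S. Arora, B. Barak, *Computational Complexity: A Modern Approach*, CUP 2009, §1.3 [AroraBarak2009].
-/

noncomputable section

namespace Literature.Computability.Cryptography

namespace Regev2009

namespace SamplerWords

open Literature.Algebra.EuclideanLattices Literature.Computability.Complexity
  Literature.Computability.Complexity.CodeFP Literature.LinearAlgebra.Matrix
  Literature.LinearAlgebra.Matrix.Berkowitz SamplerArith SamplerArithFP SamplerFormats CVPOracle
  Literature.Computability.QuantumComplexity Literature.Computability.QuantumComplexity.GaussianCells
open _root_.Computability

/-- Integer vectors: raw lists of canonical integer codes. -/
local notation "ivecE" => rawE intE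

/-- Integer matrices: raw lists of rows. -/
local notation "zmatE" => rawE (rawE intE)

/-! ### The words -/

/-- **The branch word**: `tableZ ℓY (ỹ)` computed from the point register's content. [cite: Regev2009, Lemma 3.14 (proof)] -/
def wordY (P : Par) (n ℓ ℓY : ℕ) (xb : List Bool) : List Bool :=
  tableZL ℓY (ytilL P.1.1 P.1.2 P.2.1 P.2.2 (readZ ℓ n xb))

/-- **The residue word**: the query table `table ℓR s` computed from the point register's content.
[cite: Regev2009, Lemma 3.14 (proof: "compute x mod P(L*) in a second register")] -/
def wordS (P : Par) (R n ℓ ℓR : ℕ) (xb : List Bool) : List Bool :=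
  tableL ℓR (sNatL P.1.1 P.2.1 R (readZ ℓ n xb))

/-- **The erasing word**: from the branch word, the residue word and the answer word (read off one input
word of `n·ℓY + n·ℓR + n·bc` bits) the recomposition, in the point register's format.
[cite: Regev2009, Lemma 3.14 (proof: "using the CVP oracle, we can recover x … uncompute the first register")] -/
def wordX (At : List (List ℤ)) (sg : ℤ) (R n ℓ ℓY ℓR bc : ℕ) (w : List Bool) : List Bool :=
  tableZL ℓ (recoverL At sg R (readZ ℓY n (w.take (n * ℓY))) (readN ℓR n ((w.drop (n * ℓY)).take (n * ℓR)))
    (readZ bc n (w.drop (n * ℓY + n * ℓR))))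

/-! ### Values on genuine register contents -/

section Values

variable (I : LatticeInstance) (R : ℕ) {ℓ : ℕ}

/-- The arithmetic parameters of an instance: `((rows B, rows Bᵀ), (|det B|, sign(det B)))`. [folklore] -/
def parOf : Par := ((rows I.basis, rows I.basis.transpose), ((detA I : ℤ), I.basis.det.sign))

/-- The grid vector held by the point register. [cite: Regev2009, §2 p. 11] -/
def gridVec (Y : Fin I.n → Fin ℓ → Bool) : Fin I.n → ℤ := fun i => cellPt ℓ (Y i)

/-- **The branch word on the point register is `tableZ ℓY (ytil I x̃)`.** [cite: Regev2009, Lemma 3.14 (proof)] -/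
theorem wordY_points (ℓY : ℕ) (Y : Fin I.n → Fin ℓ → Bool) :
    wordY (parOf I) I.n ℓ ℓY (pointsWord Y) = tableZ ℓY (ytil I (gridVec I Y)) := by
  unfold wordY parOf gridVec
  rw [readZ_pointsWord]
  simp only
  rw [ytilL_eq, tableZL_ofFn]

/-- **The residue word on the point register is the query table `table ℓR (sNat I R x̃)`** (`1 ≤ R`).
[cite: Regev2009, Lemma 3.14 (proof)] -/
theorem wordS_points (hR : 1 ≤ R) (ℓR : ℕ) (Y : Fin I.n → Fin ℓ → Bool) :
    wordS (parOf I) R I.n ℓ ℓR (pointsWord Y) = CVPOracle.table ℓR (sNat I R (gridVec I Y)) := by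
  unfold wordS parOf gridVec
  rw [readZ_pointsWord]
  simp only
  rw [sNatL_eq I R hR, tableL_ofFn]

/-- **The erasing word on three tables is `tableZ ℓ (recover I R y s c)`** (entries in range).
[cite: Regev2009, Lemma 3.14 (proof)] -/
theorem wordX_tables {ℓY ℓR bc : ℕ} (hℓY : 1 ≤ ℓY) (hbc : 1 ≤ bc) (y : Fin I.n → ℤ) (s : Fin I.n → ℕ) (c : Fin I.n → ℤ)
    (hy : ∀ i, -2 ^ (ℓY - 1) ≤ y i ∧ y i < 2 ^ (ℓY - 1)) (hs : ∀ i, s i < 2 ^ ℓR)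
    (hc : ∀ i, -2 ^ (bc - 1) ≤ c i ∧ c i < 2 ^ (bc - 1)) :
    wordX (rows I.basis.transpose) I.basis.det.sign R I.n ℓ ℓY ℓR bc (tableZ ℓY y ++ CVPOracle.table ℓR s ++ tableZ bc c) =
      tableZ ℓ (recover I R y s c) := by
  have hly : (tableZ ℓY y).length = I.n * ℓY := by rw [← tableZL_ofFn, length_tableZL, List.length_ofFn]
  have hls : (CVPOracle.table ℓR s).length = I.n * ℓR := by rw [← tableL_ofFn, length_tableL, List.length_ofFn]
  have h1 : (tableZ ℓY y ++ CVPOracle.table ℓR s ++ tableZ bc c).take (I.n * ℓY) = tableZ ℓY y := by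
    rw [List.append_assoc, List.take_left' hly]
  have h2 : ((tableZ ℓY y ++ CVPOracle.table ℓR s ++ tableZ bc c).drop (I.n * ℓY)).take (I.n * ℓR) = CVPOracle.table ℓR s := by
    rw [List.append_assoc, List.drop_left' hly, List.take_left' hls]
  have h3 : (tableZ ℓY y ++ CVPOracle.table ℓR s ++ tableZ bc c).drop (I.n * ℓY + I.n * ℓR) = tableZ bc c :=
    List.drop_left' (by rw [List.length_append, hly, hls])
  have ry : readZ ℓY I.n (tableZ ℓY y) = List.ofFn y := by
    have h := readZ_tableZL hℓY (c := List.ofFn y) fun z hz => by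
      obtain ⟨i, rfl⟩ := (List.mem_ofFn' _ _).1 hz; exact hy i
    rwa [List.length_ofFn, tableZL_ofFn] at h
  have rs : readN ℓR I.n (CVPOracle.table ℓR s) = List.ofFn s := by
    have h := readN_tableL (ℓ := ℓR) (s := List.ofFn s) fun v hv => by
      obtain ⟨i, rfl⟩ := (List.mem_ofFn' _ _).1 hv; exact hs i
    rwa [List.length_ofFn, tableL_ofFn] at h
  have rc : readZ bc I.n (tableZ bc c) = List.ofFn c := by
    have h := readZ_tableZL hbc (c := List.ofFn c) fun z hz => by
      obtain ⟨i, rfl⟩ := (List.mem_ofFn' _ _).1 hz; exact hc i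
    rwa [List.length_ofFn, tableZL_ofFn] at h
  unfold wordX
  rw [h1, h2, h3, ry, rs, rc, recoverL_eq, tableZL_ofFn]

/-- `tableZ ℓ x̃` is the point register's content. [folklore] -/
theorem tableZ_gridVec (Y : Fin I.n → Fin ℓ → Bool) : tableZ ℓ (gridVec I Y) = pointsWord Y := by
  rw [← tableZL_ofFn]; exact tableZL_cellPt Y

/-- **On a good answer the erasing word IS the point register's content** (`s − R·c = ⌊a⌋`): XOR-ing it
erases the first register exactly. [cite: Regev2009, Lemma 3.14 (proof: "this allows us to uncompute the first register")] -/
theorem wordX_points {ℓY ℓR bc : ℕ} (hℓY : 1 ≤ ℓY) (hbc : 1 ≤ bc) (hR : 0 < R) (hRℓ : R ≤ 2 ^ ℓR)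
    (Y : Fin I.n → Fin ℓ → Bool) (c : Fin I.n → ℤ)
    (hy : ∀ i, -2 ^ (ℓY - 1) ≤ ytil I (gridVec I Y) i ∧ ytil I (gridVec I Y) i < 2 ^ (ℓY - 1))
    (hc : ∀ i, -2 ^ (bc - 1) ≤ c i ∧ c i < 2 ^ (bc - 1))
    (hgood : ∀ j, (sNat I R (gridVec I Y) j : ℤ) - R * c j = aVec I (gridVec I Y) j) :
    wordX (rows I.basis.transpose) I.basis.det.sign R I.n ℓ ℓY ℓR bc
        (tableZ ℓY (ytil I (gridVec I Y)) ++ CVPOracle.table ℓR (sNat I R (gridVec I Y)) ++ tableZ bc c) = pointsWord Y := by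
  rw [wordX_tables I R hℓY hbc _ _ _ hy (fun i => lt_of_lt_of_le (sNat_lt hR _ i) hRℓ) hc, recover_eq_of _ hgood,
    tableZ_gridVec]

end Values

/-! ### Polynomial time on codes -/

section Codes

/-- `take` with a binary count on codes. [folklore] -/
theorem strTakeNat : CodeFP (pairE natE strE) strE (fun p => p.2.take p.1) := by
  have h : CodeFP (pairE natE strE) strE (fun p => p.2.take (min p.1 p.2.length)) :=
    (strTake.comp ((unOfNatMin.comp ((strLength.comp (snd _ _)).pair (fst _ _))).pair (snd _ _)) :)
  refine h.congr fun p => ?_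
  by_cases hle : p.1 ≤ p.2.length
  · rw [min_eq_left hle]
  · push Not at hle
    rw [min_eq_right hle.le, List.take_length, List.take_of_length_le hle.le]

/-- `drop` with a binary count on codes. [folklore] -/
theorem strDropNat : CodeFP (pairE natE strE) strE (fun p => p.2.drop p.1) := by
  have h : CodeFP (pairE natE strE) strE (fun p => p.2.drop (min p.1 p.2.length)) :=
    (strDrop.comp ((unOfNatMin.comp ((strLength.comp (snd _ _)).pair (fst _ _))).pair (snd _ _)) :)
  refine h.congr fun p => ?_
  by_cases hle : p.1 ≤ p.2.length
  · rw [min_eq_left hle]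
  · push Not at hle
    rw [min_eq_right hle.le, List.drop_length, List.drop_eq_nil_of_le hle.le]

/-- The parameter type of the branch word: `(P, (n, (ℓ, ℓY)))`, counts unary. [folklore] -/
abbrev ParY : Type := Par × (ℕ × (ℕ × ℕ))

/-- Its code. [folklore] -/
abbrev parYE : ParY → List Bool := pairE parE (pairE unE (pairE unE unE))

/-- **The branch word on codes.** [cite: Regev2009, Lemma 3.14 (proof)] [cite: AroraBarak2009, §1.3] -/
theorem codeFP_wordY : CodeFP (pairE parYE strE) strE (fun p : ParY × List Bool => wordY p.1.1 p.1.2.1 p.1.2.2.1 p.1.2.2.2 p.2) := by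
  have hP : CodeFP (pairE parYE strE) parE (fun p : ParY × List Bool => p.1.1) := (fst _ _).fst'
  have hn : CodeFP (pairE parYE strE) unE (fun p : ParY × List Bool => p.1.2.1) := (fst _ _).snd'.fst'
  have hℓ : CodeFP (pairE parYE strE) unE (fun p : ParY × List Bool => p.1.2.2.1) := (fst _ _).snd'.snd'.fst'
  have hℓY : CodeFP (pairE parYE strE) unE (fun p : ParY × List Bool => p.1.2.2.2) := (fst _ _).snd'.snd'.snd'
  have hx : CodeFP (pairE parYE strE) strE (fun p : ParY × List Bool => p.2) := snd _ _
  have hr : CodeFP (pairE parYE strE) ivecE (fun p : ParY × List Bool => readZ p.1.2.2.1 p.1.2.1 p.2) :=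
    (codeFP_readZ.comp (hℓ.pair (hn.pair hx)) :)
  have hy : CodeFP (pairE parYE strE) ivecE (fun p : ParY × List Bool =>
      ytilL p.1.1.1.1 p.1.1.1.2 p.1.1.2.1 p.1.1.2.2 (readZ p.1.2.2.1 p.1.2.1 p.2)) := (codeFP_ytilL.comp (hP.pair hr) :)
  exact (codeFP_tableZL.comp (hℓY.pair hy)).congr fun _ => rfl

/-- The parameter type of the residue word: `(P, (R, (n, (ℓ, ℓR))))`, `R` binary, counts unary. [folklore] -/
abbrev ParS : Type := Par × (ℕ × (ℕ × (ℕ × ℕ)))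

/-- Its code. [folklore] -/
abbrev parSE : ParS → List Bool := pairE parE (pairE natE (pairE unE (pairE unE unE)))

/-- **The residue word on codes.** [cite: Regev2009, Lemma 3.14 (proof)] [cite: AroraBarak2009, §1.3] -/
theorem codeFP_wordS : CodeFP (pairE parSE strE) strE
    (fun p : ParS × List Bool => wordS p.1.1 p.1.2.1 p.1.2.2.1 p.1.2.2.2.1 p.1.2.2.2.2 p.2) := by
  have hP : CodeFP (pairE parSE strE) parE (fun p : ParS × List Bool => p.1.1) := (fst _ _).fst'
  have hR : CodeFP (pairE parSE strE) natE (fun p : ParS × List Bool => p.1.2.1) := (fst _ _).snd'.fst'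
  have hn : CodeFP (pairE parSE strE) unE (fun p : ParS × List Bool => p.1.2.2.1) := (fst _ _).snd'.snd'.fst'
  have hℓ : CodeFP (pairE parSE strE) unE (fun p : ParS × List Bool => p.1.2.2.2.1) := (fst _ _).snd'.snd'.snd'.fst'
  have hℓR : CodeFP (pairE parSE strE) unE (fun p : ParS × List Bool => p.1.2.2.2.2) := (fst _ _).snd'.snd'.snd'.snd'
  have hx : CodeFP (pairE parSE strE) strE (fun p : ParS × List Bool => p.2) := snd _ _
  have hr : CodeFP (pairE parSE strE) ivecE (fun p : ParS × List Bool => readZ p.1.2.2.2.1 p.1.2.2.1 p.2) :=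
    (codeFP_readZ.comp (hℓ.pair (hn.pair hx)) :)
  have hs : CodeFP (pairE parSE strE) (rawE natE) (fun p : ParS × List Bool =>
      sNatL p.1.1.1.1 p.1.1.2.1 p.1.2.1 (readZ p.1.2.2.2.1 p.1.2.2.1 p.2)) := (codeFP_sNatL.comp ((hP.pair hR).pair hr) :)
  exact (codeFP_tableL.comp (hℓR.pair hs)).congr fun _ => rfl

/-- The parameter type of the erasing word: `((At, sg), (R, (n, (ℓ, (ℓY, (ℓR, bc))))))`. [folklore] -/
abbrev ParX : Type := (List (List ℤ) × ℤ) × (ℕ × (ℕ × (ℕ × (ℕ × (ℕ × ℕ)))))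

/-- Its code. [folklore] -/
abbrev parXE : ParX → List Bool := pairE (pairE zmatE intE) (pairE natE (pairE unE (pairE unE (pairE unE (pairE unE unE)))))

/-- **The erasing word on codes.** [cite: Regev2009, Lemma 3.14 (proof)] [cite: AroraBarak2009, §1.3] -/
theorem codeFP_wordX : CodeFP (pairE parXE strE) strE (fun p : ParX × List Bool =>
    wordX p.1.1.1 p.1.1.2 p.1.2.1 p.1.2.2.1 p.1.2.2.2.1 p.1.2.2.2.2.1 p.1.2.2.2.2.2.1 p.1.2.2.2.2.2.2 p.2) := by
  have hAt : CodeFP (pairE parXE strE) zmatE (fun p : ParX × List Bool => p.1.1.1) := (fst _ _).fst'.fst'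
  have hsg : CodeFP (pairE parXE strE) intE (fun p : ParX × List Bool => p.1.1.2) := (fst _ _).fst'.snd'
  have hR : CodeFP (pairE parXE strE) natE (fun p : ParX × List Bool => p.1.2.1) := (fst _ _).snd'.fst'
  have hn : CodeFP (pairE parXE strE) unE (fun p : ParX × List Bool => p.1.2.2.1) := (fst _ _).snd'.snd'.fst'
  have hℓ : CodeFP (pairE parXE strE) unE (fun p : ParX × List Bool => p.1.2.2.2.1) := (fst _ _).snd'.snd'.snd'.fst'
  have hℓY : CodeFP (pairE parXE strE) unE (fun p : ParX × List Bool => p.1.2.2.2.2.1) := (fst _ _).snd'.snd'.snd'.snd'.fst'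
  have hℓR : CodeFP (pairE parXE strE) unE (fun p : ParX × List Bool => p.1.2.2.2.2.2.1) :=
    (fst _ _).snd'.snd'.snd'.snd'.snd'.fst'
  have hbc : CodeFP (pairE parXE strE) unE (fun p : ParX × List Bool => p.1.2.2.2.2.2.2) :=
    (fst _ _).snd'.snd'.snd'.snd'.snd'.snd'
  have hw : CodeFP (pairE parXE strE) strE (fun p : ParX × List Bool => p.2) := snd _ _
  -- the counts `n·ℓY`, `n·ℓR`, `n·ℓY + n·ℓR` (binary)
  have hcY : CodeFP (pairE parXE strE) natE (fun p : ParX × List Bool => p.1.2.2.1 * p.1.2.2.2.2.1) :=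
    (natMul.comp ((natOfUn.comp hn).pair (natOfUn.comp hℓY)) :)
  have hcR : CodeFP (pairE parXE strE) natE (fun p : ParX × List Bool => p.1.2.2.1 * p.1.2.2.2.2.2.1) :=
    (natMul.comp ((natOfUn.comp hn).pair (natOfUn.comp hℓR)) :)
  have hcYR : CodeFP (pairE parXE strE) natE (fun p : ParX × List Bool => p.1.2.2.1 * p.1.2.2.2.2.1 + p.1.2.2.1 * p.1.2.2.2.2.2.1) :=
    (natAdd.comp (hcY.pair hcR) :)
  -- the three sub-words
  have hwy : CodeFP (pairE parXE strE) strE (fun p : ParX × List Bool => p.2.take (p.1.2.2.1 * p.1.2.2.2.2.1)) :=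
    (strTakeNat.comp (hcY.pair hw) :)
  have hws : CodeFP (pairE parXE strE) strE (fun p : ParX × List Bool =>
      (p.2.drop (p.1.2.2.1 * p.1.2.2.2.2.1)).take (p.1.2.2.1 * p.1.2.2.2.2.2.1)) :=
    (strTakeNat.comp (hcR.pair (strDropNat.comp (hcY.pair hw))) :)
  have hwa : CodeFP (pairE parXE strE) strE (fun p : ParX × List Bool =>
      p.2.drop (p.1.2.2.1 * p.1.2.2.2.2.1 + p.1.2.2.1 * p.1.2.2.2.2.2.1)) := (strDropNat.comp (hcYR.pair hw) :)
  -- readers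
  have hry : CodeFP (pairE parXE strE) ivecE (fun p : ParX × List Bool =>
      readZ p.1.2.2.2.2.1 p.1.2.2.1 (p.2.take (p.1.2.2.1 * p.1.2.2.2.2.1))) := (codeFP_readZ.comp (hℓY.pair (hn.pair hwy)) :)
  have hrs : CodeFP (pairE parXE strE) (rawE natE) (fun p : ParX × List Bool =>
      readN p.1.2.2.2.2.2.1 p.1.2.2.1 ((p.2.drop (p.1.2.2.1 * p.1.2.2.2.2.1)).take (p.1.2.2.1 * p.1.2.2.2.2.2.1))) :=
    (codeFP_readN.comp (hℓR.pair (hn.pair hws)) :)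
  have hra : CodeFP (pairE parXE strE) ivecE (fun p : ParX × List Bool =>
      readZ p.1.2.2.2.2.2.2 p.1.2.2.1 (p.2.drop (p.1.2.2.1 * p.1.2.2.2.2.1 + p.1.2.2.1 * p.1.2.2.2.2.2.1))) :=
    (codeFP_readZ.comp (hbc.pair (hn.pair hwa)) :)
  have hrec : CodeFP (pairE parXE strE) ivecE (fun p : ParX × List Bool =>
      recoverL p.1.1.1 p.1.1.2 p.1.2.1 (readZ p.1.2.2.2.2.1 p.1.2.2.1 (p.2.take (p.1.2.2.1 * p.1.2.2.2.2.1)))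
        (readN p.1.2.2.2.2.2.1 p.1.2.2.1 ((p.2.drop (p.1.2.2.1 * p.1.2.2.2.2.1)).take (p.1.2.2.1 * p.1.2.2.2.2.2.1)))
        (readZ p.1.2.2.2.2.2.2 p.1.2.2.1 (p.2.drop (p.1.2.2.1 * p.1.2.2.2.2.1 + p.1.2.2.1 * p.1.2.2.2.2.2.1)))) :=
    (codeFP_recoverL.comp (((hAt.pair hsg).pair hR).pair (hry.pair (hrs.pair hra))) :)
  exact (codeFP_tableZL.comp (hℓ.pair hrec)).congr fun _ => rfl

end Codes

end SamplerWords

end Regev2009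

end Literature.Computability.Cryptography

end
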